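import Summits.RiemannHypothesis.RiemannHypothesis.Theorems.WeilFormatCDeflatedFarCouplingGramB
import Mathlib.Analysis.SpecialFunctions.Log.Basic
import HarnessLib

/-!
# Format C, design C∞ (E3, analytic side): the structured tail over a `Fintype` family index; the four tag groups as one family sum

Route context: Fourier–Galerkin / Schur-complement certificates of Weil positivity on a window ("format C", C∞ door;
cell memo `run/shared/lean/pub/rh-explicit/rh-explicit-weil-10/KERNEL-LEVER.md` §21; supporting stmt-RiemannHypothesis-0098;
seat rh-explicit-weil-10).  `coupling_majorant_gram_shifted` (the `hUq` of the DoorB certificates) indexes the tail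
families by `Fin F`.  The collected monomial forms of the rows and images (`WeilFormatCCinfRowCollected`,
`WeilFormatCCinfImageCollected`) are naturally indexed by (tag, power) pairs.  Here:

* `coupling_majorant_gram_shifted_fintype` — the same theorem over an arbitrary `Fintype` family index `ι`
  (transport along `Fintype.equivFin`);
* `fourGroups_eq_sum_fin` — `Σ_{d≤D} P₁(d)/m^d + L·Σ_d P_L(d)/m^d − C·Σ_d P_C(d)/m^d + S·Σ_d P_S(d)/m^d`
  `= Σ_{x : Fin 4 × Fin (D+1)} (![P₁, P_L, P_C, P_S] x.1 x.2)·(![1, L, −C, S] x.1 / m^{x.2})` — the four collected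
  groups as ONE family sum over `ι = Fin 4 × Fin (D+1)` (tags `1`, `log m`, `−C_m`, `S_m`);
* `twoGroups_eq_sum_fin` — the rows' two groups (`1`, `S_m`) over the same index set (zero `log`/`C` rows), so rows
  and images share one family index.

Pure finite-dimensional algebra; standard axioms; no definitions; no RH claim.
-/

set_option autoImplicit false
-- `Summit.RiemannHypothesis.RiemannHypothesis.…` is the layout-mandated namespace (summit = problem name).
set_option linter.dupNamespace false

namespace Summit.RiemannHypothesis.RiemannHypothesis.Theorems.WeilFormatC

open Finset

/-! ## `coupling_majorant_gram_shifted` over a `Fintype` index -/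

/-- **The structured tail for the shifted coupling, families indexed by a `Fintype`.**  Verbatim
`coupling_majorant_gram_shifted` with `Fin F` replaced by any finite index type `ι` (e.g. (tag, power) pairs). -/
theorem coupling_majorant_gram_shifted_fintype {ι : Type*} [Fintype ι] (M : ℕ → ℕ → ℝ) {B B₃ r : ℕ}
    (hBB : B ≤ B₃) (c V : ℕ → Fin r → ℝ)
    (Λ₁ : Fin r → Fin B → ℝ) (Λ₂ : Fin r → Fin r → ℝ)
    (dhat : ℕ → ℝ) (hd : ∀ m, B ≤ m → 0 < dhat m) {d₀ : ℝ} (hd₀ : 0 < d₀) (hd₃ : ∀ m, B₃ ≤ m → d₀ ≤ dhat m)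
    (Ufin : (Fin B → ℝ) → (Fin r → ℝ) → ℝ)
    (hfin : ∀ (x : Fin B → ℝ) (β : Fin r → ℝ),
      ∑ m ∈ Ico B B₃, (∑ i : Fin B, M i m * x i + ∑ j, c m j * β j
        - ∑ j, V m j * (∑ i, Λ₁ j i * x i + ∑ j', Λ₂ j j' * β j')) ^ 2 / dhat m ≤ Ufin x β)
    (ε : ℕ → ℝ) (hε : ∀ m, ε m ^ 2 = 1)
    (φ : ι → ℕ → ℝ) (P : ι → Fin B → ℝ) (Q R : ι → Fin r → ℝ)
    (w : ℕ → ℝ) (ρx : Fin B → ℝ) (ρβ : Fin r → ℝ) (hρx : ∀ i, 0 ≤ ρx i) (hρβ : ∀ j, 0 ≤ ρβ j)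
    (hM : ∀ m, B₃ ≤ m → ∀ i : Fin B, |M i m - ε m * ∑ f, P f i * φ f m| ≤ ρx i * w m)
    (hc : ∀ m, B₃ ≤ m → ∀ j : Fin r, |c m j - ε m * ∑ f, Q f j * φ f m| ≤ ρβ j * w m)
    (hV : ∀ m, B₃ ≤ m → ∀ j : Fin r, V m j = ε m * ∑ f, R f j * φ f m)
    {W : ℝ} (hW : ∀ N, ∑ m ∈ Ico B₃ N, w m ^ 2 ≤ W)
    (Γ : (ι → ℝ) → ℝ) (hΓ : ∀ (N : ℕ) (u : ι → ℝ), ∑ m ∈ Ico B₃ N, (∑ f, u f * φ f m) ^ 2 ≤ Γ u)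
    {θ : ℝ} (hθ : 0 < θ) (N : ℕ) (x : Fin B → ℝ) (β : Fin r → ℝ) :
    ∑ m ∈ Ico B N, (∑ i : Fin B, M i m * x i + ∑ j, c m j * β j
        - ∑ j, V m j * (∑ i, Λ₁ j i * x i + ∑ j', Λ₂ j j' * β j')) ^ 2 / dhat m
      ≤ Ufin x β + ((1 + θ) * Γ (fun f ↦ ∑ i, (P f i - ∑ j, R f j * Λ₁ j i) * x i
            + ∑ j', (Q f j' - ∑ j, R f j * Λ₂ j j') * β j')
          + (1 + 1 / θ) * (W * ((∑ i, ρx i + ∑ j, ρβ j) * (∑ i, ρx i * x i ^ 2 + ∑ j, ρβ j * β j ^ 2)))) / d₀ := by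
  classical
  set e := Fintype.equivFin ι with he
  -- transport every family datum to `Fin (card ι)`
  have hsum : ∀ g : ι → ℝ, ∑ f : Fin (Fintype.card ι), g (e.symm f) = ∑ x : ι, g x :=
    fun g ↦ Equiv.sum_comp e.symm g
  have hM' : ∀ m, B₃ ≤ m → ∀ i : Fin B,
      |M i m - ε m * ∑ f : Fin (Fintype.card ι), P (e.symm f) i * φ (e.symm f) m| ≤ ρx i * w m := by
    intro m hm i; rw [hsum (fun x ↦ P x i * φ x m)]; exact hM m hm i
  have hc' : ∀ m, B₃ ≤ m → ∀ j : Fin r,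
      |c m j - ε m * ∑ f : Fin (Fintype.card ι), Q (e.symm f) j * φ (e.symm f) m| ≤ ρβ j * w m := by
    intro m hm j; rw [hsum (fun x ↦ Q x j * φ x m)]; exact hc m hm j
  have hV' : ∀ m, B₃ ≤ m → ∀ j : Fin r,
      V m j = ε m * ∑ f : Fin (Fintype.card ι), R (e.symm f) j * φ (e.symm f) m := by
    intro m hm j; rw [hsum (fun x ↦ R x j * φ x m)]; exact hV m hm j
  have hΓ' : ∀ (N : ℕ) (u : Fin (Fintype.card ι) → ℝ),
      ∑ m ∈ Ico B₃ N, (∑ f, u f * φ (e.symm f) m) ^ 2 ≤ Γ (fun t ↦ u (e t)) := by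
    intro N u
    have h := hΓ N (fun t ↦ u (e t))
    have hrw : ∀ m, ∑ t : ι, u (e t) * φ t m = ∑ f : Fin (Fintype.card ι), u f * φ (e.symm f) m := by
      intro m
      rw [← hsum (fun t ↦ u (e t) * φ t m)]
      simp only [Equiv.apply_symm_apply]
    simp only [hrw] at h
    exact h
  have key := coupling_majorant_gram_shifted M hBB c V Λ₁ Λ₂ dhat hd hd₀ hd₃ Ufin hfin ε hε
    (fun f ↦ φ (e.symm f)) (fun f ↦ P (e.symm f)) (fun f ↦ Q (e.symm f)) (fun f ↦ R (e.symm f))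
    w ρx ρβ hρx hρβ hM' hc' hV' hW (fun u ↦ Γ (fun t ↦ u (e t))) hΓ' hθ N x β
  have hu : (fun t ↦ (fun f : Fin (Fintype.card ι) ↦ ∑ i, (P (e.symm f) i - ∑ j, R (e.symm f) j * Λ₁ j i) * x i
        + ∑ j', (Q (e.symm f) j' - ∑ j, R (e.symm f) j * Λ₂ j j') * β j') (e t))
      = (fun f ↦ ∑ i, (P f i - ∑ j, R f j * Λ₁ j i) * x i + ∑ j', (Q f j' - ∑ j, R f j * Λ₂ j j') * β j') := by
    funext t
    simp only [Equiv.symm_apply_apply]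
  rw [hu] at key
  exact key

/-! ## The tag groups as one family sum -/

/-- A `range (D+1)` monomial sum as a `Fin (D+1)` sum. -/
theorem sum_range_div_pow_eq_sum_fin (P : ℕ → ℝ) (m : ℝ) (D : ℕ) :
    ∑ d ∈ Finset.range (D + 1), P d / m ^ d = ∑ d : Fin (D + 1), P d / m ^ (d : ℕ) := by
  rw [Finset.sum_range]

/-- **The four collected groups as ONE family sum** over `Fin 4 × Fin (D+1)` (tags `1`, `L`, `−C`, `S`). -/
theorem fourGroups_eq_sum_fin (P₁ PL PC PS : ℕ → ℝ) (L C S m : ℝ) (D : ℕ) :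
    (∑ d ∈ Finset.range (D + 1), P₁ d / m ^ d) + L * ∑ d ∈ Finset.range (D + 1), PL d / m ^ d
        - C * ∑ d ∈ Finset.range (D + 1), PC d / m ^ d + S * ∑ d ∈ Finset.range (D + 1), PS d / m ^ d
      = ∑ x : Fin 4 × Fin (D + 1), (![P₁, PL, PC, PS] x.1) x.2 * (![(1 : ℝ), L, -C, S] x.1 / m ^ (x.2 : ℕ)) := by
  rw [Fintype.sum_prod_type, Fin.sum_univ_four]
  simp only [Matrix.cons_val_zero, Matrix.cons_val_one, Matrix.cons_val]
  simp only [sum_range_div_pow_eq_sum_fin, Finset.mul_sum]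
  have e1 : ∑ d : Fin (D + 1), P₁ d / m ^ (d : ℕ) = ∑ d : Fin (D + 1), P₁ d * (1 / m ^ (d : ℕ)) :=
    Finset.sum_congr rfl fun d _ ↦ by ring
  have e2 : ∑ d : Fin (D + 1), L * (PL d / m ^ (d : ℕ)) = ∑ d : Fin (D + 1), PL d * (L / m ^ (d : ℕ)) :=
    Finset.sum_congr rfl fun d _ ↦ by ring
  have e3 : ∑ d : Fin (D + 1), C * (PC d / m ^ (d : ℕ)) = -∑ d : Fin (D + 1), PC d * (-C / m ^ (d : ℕ)) := by
    rw [← Finset.sum_neg_distrib]; exact Finset.sum_congr rfl fun d _ ↦ by ring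
  have e4 : ∑ d : Fin (D + 1), S * (PS d / m ^ (d : ℕ)) = ∑ d : Fin (D + 1), PS d * (S / m ^ (d : ℕ)) :=
    Finset.sum_congr rfl fun d _ ↦ by ring
  rw [e1, e2, e3, e4]
  ring

/-- **The rows' two groups** (tags `1`, `S`) over the same index `Fin 4 × Fin (D+1)` (zero `L`- and `C`-rows). -/
theorem twoGroups_eq_sum_fin (P₁ PS : ℕ → ℝ) (L C S m : ℝ) (D : ℕ) :
    (∑ d ∈ Finset.range (D + 1), P₁ d / m ^ d) + S * ∑ d ∈ Finset.range (D + 1), PS d / m ^ d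
      = ∑ x : Fin 4 × Fin (D + 1),
          (![P₁, fun _ ↦ 0, fun _ ↦ 0, PS] x.1) x.2 * (![(1 : ℝ), L, -C, S] x.1 / m ^ (x.2 : ℕ)) := by
  rw [← fourGroups_eq_sum_fin P₁ (fun _ ↦ 0) (fun _ ↦ 0) PS L C S m D]
  simp only [zero_div, Finset.sum_const_zero, mul_zero, add_zero, sub_zero]

/-! ## Linear combinations of collected objects -/

/-- **A real linear combination of collected objects is collected** (the images of a polynomial profile from the
monomial images; the block-rows × profile-table part of the DoorB image entry): if
`|X_q − ε·Σ_f A_q(f)φ_f| ≤ ρ_q·w` for `q ∈ s`, then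
`|Σ_{q∈s} c_q X_q − ε·Σ_f (Σ_{q∈s} c_q A_q(f))φ_f| ≤ (Σ_{q∈s} |c_q|ρ_q)·w`. -/
theorem abs_sum_mul_sub_collected_le {ι κ : Type*} [Fintype ι] (s : Finset κ) (c : κ → ℝ) (X : κ → ℝ)
    (A : κ → ι → ℝ) (φ : ι → ℝ) (ε w : ℝ) (ρ : κ → ℝ)
    (h : ∀ q ∈ s, |X q - ε * ∑ f, A q f * φ f| ≤ ρ q * w) :
    |∑ q ∈ s, c q * X q - ε * ∑ f, (∑ q ∈ s, c q * A q f) * φ f| ≤ (∑ q ∈ s, |c q| * ρ q) * w := by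
  have hre : ∑ q ∈ s, c q * X q - ε * ∑ f, (∑ q ∈ s, c q * A q f) * φ f
      = ∑ q ∈ s, c q * (X q - ε * ∑ f, A q f * φ f) := by
    have h1 : ∑ f, (∑ q ∈ s, c q * A q f) * φ f = ∑ q ∈ s, c q * ∑ f, A q f * φ f := by
      rw [Finset.sum_congr rfl fun f _ ↦ Finset.sum_mul s (fun q ↦ c q * A q f) (φ f), Finset.sum_comm]
      refine Finset.sum_congr rfl fun q _ ↦ ?_
      rw [Finset.mul_sum]
      exact Finset.sum_congr rfl fun f _ ↦ by ring
    rw [h1, Finset.mul_sum, ← Finset.sum_sub_distrib]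
    exact Finset.sum_congr rfl fun q _ ↦ by ring
  rw [hre, Finset.sum_mul]
  refine (Finset.abs_sum_le_sum_abs _ _).trans (Finset.sum_le_sum fun q hq ↦ ?_)
  rw [abs_mul, mul_assoc]
  exact mul_le_mul_of_nonneg_left (h q hq) (abs_nonneg _)

/-- **Scaling a collected object** (e.g. the factor `(2a)^{-1/2}` of the images): if `|X − c·ε·U| ≤ c·ρ·w` with
`U = Σ_f A(f)φ_f`, then `|X − ε·Σ_f (c·A(f))φ_f| ≤ (c·ρ)·w`. -/
theorem abs_sub_collected_scale {ι : Type*} [Fintype ι] (X c ε w ρ : ℝ) (A φ : ι → ℝ)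
    (h : |X - c * ε * ∑ f, A f * φ f| ≤ c * ρ * w) :
    |X - ε * ∑ f, (c * A f) * φ f| ≤ (c * ρ) * w := by
  have e : ε * ∑ f, (c * A f) * φ f = c * ε * ∑ f, A f * φ f := by
    rw [Finset.mul_sum, Finset.mul_sum]
    exact Finset.sum_congr rfl fun f _ ↦ by ring
  rw [e]
  exact h

end Summit.RiemannHypothesis.RiemannHypothesis.Theorems.WeilFormatC
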